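import Literature.AlgebraicGeometry.Resolution.LogRegularResolution
import Mathlib.RingTheory.Ideal.Basic
import HarnessLib

/-!
# Crux `FrobeniusLadder.FRationalResolution` (stmt-ResolutionOfSingularities-15317), line `redirect`,
# stub `stub_diagonalizableQuotientResolution` — Kato's condition (2.1) is invariant under replacing a chart by a QUOTIENT chart
# that agrees with it UP TO UNITS (first brick of the «sharpening» step for WILD non-fixed points, memo MEMO-15317-leafhand4-g1 §remaining (1))

Generic commutative algebra. Two charts `φ : P → A` (`P ⊆ ℤᴺ`) and `ψ : P' → A` (`P' ⊆ ℤⁿ`) and an additive `π : P → P'` with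
`φ(p) = ψ(π p) · u_p`, `u_p ∈ Aˣ` (the situation of the unit-exponent chart of `…WildLogRegularNhd` versus its projection to the
non-unit exponents, after inverting the unit monomials). Then at every prime `𝔭`: the faces correspond (`F_𝔭(φ) = π⁻¹ F_𝔭(ψ)`), the
Kato ideals COINCIDE when `π` is onto (`I_φ(𝔭) = I_ψ(𝔭)`: generators differ by units), hence Kato's regularity condition (2.1)(i) is
the same for both charts, and (2.1)(ii) is the same as soon as the rank terms `N − rk F_𝔭(φ)ᵍᵖ` and `n − rk F_𝔭(ψ)ᵍᵖ` agree (a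
purely combinatorial statement about `π`, supplied by the user).

* `face_eq_preimage` — `LogChart.face P φ 𝔭 = π ⁻¹' LogChart.face P' ψ 𝔭`;
* `ideal_le_of_units`, `ideal_eq_of_units` — `LogChart.ideal P φ 𝔭 = LogChart.ideal P' ψ 𝔭` (`π` onto);
* **`isLogRegularAt_iff_of_units`** — `IsLogRegularAt P φ 𝔭 ↔ IsLogRegularAt P' ψ 𝔭` given the rank identity.

Honest label: generic brick (no stub closed). No definitions, no named facts, no sorry. [cite: Kato1994, (1.5)–(1.6), Def. (2.1)]
-/

-- single-problem summit: the doubled namespace component is forced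
set_option linter.dupNamespace false

open Literature.AlgebraicGeometry.Resolution

namespace Summit.ResolutionOfSingularities.ResolutionOfSingularities.Theorems.FRationalResolution.LogChartUnitTransfer

universe u

variable {A : Type u} [CommRing A] {N n : ℕ} {P : AddSubmonoid (Fin N → ℤ)} {P' : AddSubmonoid (Fin n → ℤ)}
  (φ : Multiplicative P →* A) (ψ : Multiplicative P' →* A) (π : P →+ P')

/-- **Faces correspond**: if `φ(p) = ψ(π p) · u_p` with `u_p` a unit, then `φ(p) ∉ 𝔭 ↔ ψ(π p) ∉ 𝔭`.
[cite: Kato1994, (1.5)–(1.6)] -/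
theorem face_eq_preimage (𝔭 : Ideal A) [𝔭.IsPrime]
    (hrel : ∀ p : P, ∃ u : A, IsUnit u ∧ φ (Multiplicative.ofAdd p) = ψ (Multiplicative.ofAdd (π p)) * u) :
    LogChart.face P φ 𝔭 = π ⁻¹' LogChart.face P' ψ 𝔭 := by
  ext p
  obtain ⟨u, hu, hp⟩ := hrel p
  rw [Set.mem_preimage, LogChart.mem_face_iff, LogChart.mem_face_iff, hp, Ideal.mul_unit_mem_iff_mem 𝔭 hu]

/-- `I_φ(𝔭) ⊆ I_ψ(𝔭)`: each generator `φ(p)`, `φ(p) ∈ 𝔭`, is a unit multiple of the generator `ψ(π p) ∈ 𝔭`.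
[cite: Kato1994, Def. (2.1)] -/
theorem ideal_le_of_units (𝔭 : Ideal A) [𝔭.IsPrime]
    (hrel : ∀ p : P, ∃ u : A, IsUnit u ∧ φ (Multiplicative.ofAdd p) = ψ (Multiplicative.ofAdd (π p)) * u) :
    LogChart.ideal P φ 𝔭 ≤ LogChart.ideal P' ψ 𝔭 := by
  refine Ideal.span_le.2 ?_
  rintro _ ⟨p, hp, rfl⟩
  obtain ⟨u, hu, hpu⟩ := hrel p
  have hp' : ψ (Multiplicative.ofAdd (π p)) ∈ 𝔭 := by
    have h : φ (Multiplicative.ofAdd p) ∈ 𝔭 := hp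
    rwa [hpu, Ideal.mul_unit_mem_iff_mem 𝔭 hu] at h
  change φ (Multiplicative.ofAdd p) ∈ LogChart.ideal P' ψ 𝔭
  rw [hpu]
  exact Ideal.mul_mem_right _ _ (Ideal.subset_span ⟨π p, hp', rfl⟩)

/-- **The Kato ideals coincide** when `π` is onto: `I_φ(𝔭) = I_ψ(𝔭)`. [cite: Kato1994, Def. (2.1)] -/
theorem ideal_eq_of_units (𝔭 : Ideal A) [𝔭.IsPrime] (hπ : Function.Surjective π)
    (hrel : ∀ p : P, ∃ u : A, IsUnit u ∧ φ (Multiplicative.ofAdd p) = ψ (Multiplicative.ofAdd (π p)) * u) :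
    LogChart.ideal P φ 𝔭 = LogChart.ideal P' ψ 𝔭 := by
  refine le_antisymm (ideal_le_of_units φ ψ π 𝔭 hrel) (Ideal.span_le.2 ?_)
  rintro _ ⟨p', hp', rfl⟩
  obtain ⟨p, rfl⟩ := hπ p'
  obtain ⟨u, hu, hpu⟩ := hrel p
  obtain ⟨v, rfl⟩ := hu
  have hφp : φ (Multiplicative.ofAdd p) ∈ 𝔭 := by
    have h : ψ (Multiplicative.ofAdd (π p)) ∈ 𝔭 := hp'
    rw [hpu]
    exact Ideal.mul_mem_right _ _ h
  -- `ψ(π p) = φ(p) · v⁻¹`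
  have heq : ψ (Multiplicative.ofAdd (π p)) = φ (Multiplicative.ofAdd p) * ↑v⁻¹ := by
    rw [hpu, mul_assoc, Units.mul_inv, mul_one]
  change ψ (Multiplicative.ofAdd (π p)) ∈ LogChart.ideal P φ 𝔭
  rw [heq]
  exact Ideal.mul_mem_right _ _ (Ideal.subset_span ⟨p, hφp, rfl⟩)

/-- **Kato's (2.1) transfers between charts that agree up to units**, given the rank identity
`N − rk F_𝔭(φ)ᵍᵖ = n − rk F_𝔭(ψ)ᵍᵖ` (the Kato ideals coincide by `ideal_eq_of_units`, so (2.1)(i) and the dimension terms of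
(2.1)(ii) are literally the same). [cite: Kato1994, Def. (2.1)] -/
theorem isLogRegularAt_iff_of_units (𝔭 : Ideal A) [𝔭.IsPrime] (hπ : Function.Surjective π)
    (hrel : ∀ p : P, ∃ u : A, IsUnit u ∧ φ (Multiplicative.ofAdd p) = ψ (Multiplicative.ofAdd (π p)) * u)
    (hrank : N - Module.finrank ℤ (Submodule.span ℤ ((fun p : P => (p : Fin N → ℤ)) '' LogChart.face P φ 𝔭)) =
      n - Module.finrank ℤ (Submodule.span ℤ ((fun p : P' => (p : Fin n → ℤ)) '' LogChart.face P' ψ 𝔭))) :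
    LogChart.IsLogRegularAt P φ 𝔭 ↔ LogChart.IsLogRegularAt P' ψ 𝔭 := by
  rw [LogChart.IsLogRegularAt, LogChart.IsLogRegularAt, ideal_eq_of_units φ ψ π 𝔭 hπ hrel, hrank]

/-- One-directional form used downstream: log regularity of `φ` at `𝔭` implies log regularity of the quotient chart `ψ`.
[cite: Kato1994, Def. (2.1)] -/
theorem isLogRegularAt_of_units (𝔭 : Ideal A) [𝔭.IsPrime] (hπ : Function.Surjective π)
    (hrel : ∀ p : P, ∃ u : A, IsUnit u ∧ φ (Multiplicative.ofAdd p) = ψ (Multiplicative.ofAdd (π p)) * u)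
    (hrank : N - Module.finrank ℤ (Submodule.span ℤ ((fun p : P => (p : Fin N → ℤ)) '' LogChart.face P φ 𝔭)) =
      n - Module.finrank ℤ (Submodule.span ℤ ((fun p : P' => (p : Fin n → ℤ)) '' LogChart.face P' ψ 𝔭)))
    (h : LogChart.IsLogRegularAt P φ 𝔭) : LogChart.IsLogRegularAt P' ψ 𝔭 :=
  (isLogRegularAt_iff_of_units φ ψ π 𝔭 hπ hrel hrank).mp h

end Summit.ResolutionOfSingularities.ResolutionOfSingularities.Theorems.FRationalResolution.LogChartUnitTransfer
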